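import Summits.QuantumFields.YangMills.Theorems.BalabanUVNodesPortS1G3CWalks

/-!
# NODE O port PT-A — `stub_G3C` (repaired edition `G3CAtRecordL`), layer (D4d-a): VANISHING OF DISCONNECTED WALKS

A walk term `t(□₀, w) = Tr[G_{□₀}𝟙_{□₀}·S^M(w₀)⋯S^M(w_{m−1})]`, `w_i = (□_{i+1}, Y_{i+1})`, VANISHES unless every step is admissible (`Y ⊄ □̃`), meets its block (`Y ∩ □̃ ≠ ∅`), and
contains the previous cube (`□₀ ∈ Y₁`, `□_i ∈ Y_{i+1}`) — the support rule ✓`g3cInd_mul_nonB0Block_of_not_mem` (p822817) and the column support of `T_Y`.  These are the facts from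
which layer (D4d-b) shows that the localization `X(□₀, w)` of a non-vanishing walk is a DOMAIN with `d_j(X) ≤ d_j(□̃₀) + Σ_i (d_j(Y_i) + d_j(□̃_i) + 4)` (memo §5c).
Cell `ym-nodeO-ideate`, porter hand `hand-27930-G3C` (g0); proof kind, `--supports stmt-QuantumFields-27930 --as helper`; count-neutral.

WHAT THIS FILE PROVES (sorry-free): `g3cStepM_mul_g3cInd`, `g3cInd_mul_g3cStepM_of_not_mem`, `nonB0Block_mul_g3cProj_of_disjoint`, `g3cStep_eq_zero_of_disjoint`, `g3cStepM_eq_zero_of_subset`,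
`g3cStepM_eq_zero_of_disjoint`; `g3cWalkTerm_eq_zero_of_exists_stepM_eq_zero`, ★ `g3cWalkTerm_eq_zero_of_subset`, ★ `g3cWalkTerm_eq_zero_of_disjoint`, ★ `g3cWalkTerm_eq_zero_of_root_not_mem`,
`prod_ofFn_stepM_eq_zero_of_consec`, ★ `g3cWalkTerm_eq_zero_of_consec_not_mem`.

HONEST FRAMING.  Finite algebra under the HYPOTHESIS `P0CarrierClauses …` (inhabited nowhere); nothing of Bałaban asserted, ported or discharged; `stub_G3C` NOT closed; 27930 OPEN; NODE O 0∕1;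
COUNT 8∕28 · K 1∕4 UNMOVED; **the Yang–Mills mass gap is NOT proved by any of this.**  No `sorry`, no `instance`, no `notation`, no `def`; standard axioms.
-/

noncomputable section

open scoped BigOperators Matrix.Norms.L2Operator Topology Matrix Classical
open Filter Finset

namespace Summit.QuantumFields.YangMills.Theorems.BalabanUVNodesPortS1

open Summit.QuantumFields.YangMills.Theorems.K0RecordFormatNames
open Literature.MathematicalPhysics.QuantumFieldTheory.Balaban1983to89
open Literature.MathematicalPhysics.QuantumFieldTheory.Balaban1983to89.Node00
open Literature.MathematicalPhysics.QuantumFieldTheory.Balaban1983to89.T4Continuum (T4Family)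
open Literature.MathematicalPhysics.QuantumFieldTheory.Balaban1983to89.TreeLengthTorus (TPt IsTDom)

section Record

variable {F : T4Family}
variable {a₀ δ₀ c₀ γ₀ γ₁ δ₁ : ℝ} {Mc : ℕ} {α₀ α₁ ε₂₉ : ℝ} {k : ℕ}
variable {TC : (n : ℕ) → Sect2.CPair (F.P (recordK₀ F Mc k + n)) (MatA 2) → FluctIdx F k (recordK₀ F Mc k + n) → FluctIdx F k (recordK₀ F Mc k + n) → ℂ}
variable {TY : (n : ℕ) → (recordDomSys F Mc k (recordK₀ F Mc k + n)).Dom → Sect2.CPair (F.P (recordK₀ F Mc k + n)) (MatA 2) →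
  FluctIdx F k (recordK₀ F Mc k + n) → FluctIdx F k (recordK₀ F Mc k + n) → ℂ}
variable {TZY : Finset (Fin 4 → ℤ) → IntBondCfg → ((Fin 4 → ℤ) × Fin 4) × Fin 3 → ((Fin 4 → ℤ) × Fin 4) × Fin 3 → ℂ}
variable {AdM : (n : ℕ) → (Site (F.P (recordK₀ F Mc k + n)) 0 → (MatA 2)ˣ) →
  Matrix (FluctIdx F k (recordK₀ F Mc k + n)) (FluctIdx F k (recordK₀ F Mc k + n)) ℂ}
variable {AdZ : ((Fin 4 → ℤ) → (MatA 2)ˣ) → (Fin 4 → ℤ) × Fin 4 → Matrix (Fin 3) (Fin 3) ℂ}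

/-! ### Step-level facts -/

/-- `S^M_{□,Y}·𝟙_□ = S^M_{□,Y}`. [folklore] -/
theorem g3cStepM_mul_g3cInd {K : ℕ} (Mc k : ℕ) (TYK : (recordDomSys F Mc k K).Dom → Sect2.CPair (F.P K) (MatA 2) → FluctIdx F k K → FluctIdx F k K → ℂ) (x : ℝ)
    (φ : Sect2.CPair (F.P K) (MatA 2)) (s : TPt (F.P K).d (Sect2.domCount (F.P K) Mc (k + 1)) × (recordDomSys F Mc k K).Dom) :
    g3cStepM F Mc k K TYK x φ s * g3cInd F Mc k K s.1 = g3cStepM F Mc k K TYK x φ s := by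
  rw [g3cStepM]
  split_ifs
  · rw [Matrix.zero_mul]
  · exact g3cStep_mul_g3cInd Mc k K TYK s.1 s.2 x φ

/-- `𝟙_c·S^M_{□,Y} = 0` unless `c ∈ Y`. [cite: Balaban1985BackgroundPropagators, (3.90) p.409] -/
theorem g3cInd_mul_g3cStepM_of_not_mem (hP : P0CarrierClauses F a₀ δ₀ c₀ γ₀ γ₁ Mc α₀ α₁ ε₂₉ k TC TY TZY AdM AdZ) (hMc : McGuard F Mc) (n : ℕ)
    (c : TPt (F.P (recordK₀ F Mc k + n)).d (Sect2.domCount (F.P (recordK₀ F Mc k + n)) Mc (k + 1)))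
    (s : TPt (F.P (recordK₀ F Mc k + n)).d (Sect2.domCount (F.P (recordK₀ F Mc k + n)) Mc (k + 1)) × (recordDomSys F Mc k (recordK₀ F Mc k + n)).Dom)
    (hc : c ∉ (s.2.1 : Finset _)) (x : ℝ) (φ : Sect2.CPair (F.P (recordK₀ F Mc k + n)) (MatA 2)) :
    g3cInd F Mc k (recordK₀ F Mc k + n) c * g3cStepM F Mc k (recordK₀ F Mc k + n) (TY n) x φ s = 0 := by
  rw [g3cStepM]
  split_ifs
  · rw [Matrix.mul_zero]
  · exact g3cInd_mul_g3cStep_of_not_mem hP hMc n c s.1 s.2 hc x φ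

/-- **Column support**: `T_Y·P_Z = 0` if no cube of `Y` lies in `Z`. [cite: Balaban1987RG1, (1.7) p.261] -/
theorem nonB0Block_mul_g3cProj_of_disjoint (hP : P0CarrierClauses F a₀ δ₀ c₀ γ₀ γ₁ Mc α₀ α₁ ε₂₉ k TC TY TZY AdM AdZ) (hMc : McGuard F Mc) (n : ℕ)
    (Y Z : (recordDomSys F Mc k (recordK₀ F Mc k + n)).Dom) (hYZ : ∀ c ∈ (Y.1 : Finset _), c ∉ (Z.1 : Finset _))
    (φ : Sect2.CPair (F.P (recordK₀ F Mc k + n)) (MatA 2)) :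
    nonB0Block F k (recordK₀ F Mc k + n) (TY n Y φ) * g3cProj F Mc k (recordK₀ F Mc k + n) Z = 0 := by
  obtain ⟨-, -, -, -, -, -, -, -, hSupp, -⟩ := hP
  have hK : recordK₀ F Mc k ≤ recordK₀ F Mc k + n := Nat.le_add_right _ _
  ext i j
  rw [g3cProj, Matrix.mul_diagonal, Matrix.zero_apply]
  by_cases hj : g3cInDom F Mc k (recordK₀ F Mc k + n) Z j
  · have hjZ : cubeOfSite F Mc k (recordK₀ F Mc k + n) (blockOf j.1.1.src) ∈ (Z.1 : Finset _) :=
      cubeOfSite_blockOf_mem_of_embIter_mem_domSites hMc hK _ _ hj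
    have hjY : cubeOfSite F Mc k (recordK₀ F Mc k + n) (blockOf j.1.1.src) ∉ (Y.1 : Finset _) := fun h => hYZ _ h hjZ
    rw [nonB0Block, Matrix.of_apply, fluct_supp_of_cube hMc hK (hSupp n) Y φ i j (Or.inr hjY), zero_mul]
  · rw [if_neg hj, mul_zero]

/-- **A step whose piece misses its block vanishes**: `S_{□,Y} = 0` if `Y ∩ □̃ = ∅`. [cite: Balaban1985BackgroundPropagators, (3.88) p.409] -/
theorem g3cStep_eq_zero_of_disjoint (hP : P0CarrierClauses F a₀ δ₀ c₀ γ₀ γ₁ Mc α₀ α₁ ε₂₉ k TC TY TZY AdM AdZ) (hMc : McGuard F Mc) (n : ℕ)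
    (q : TPt (F.P (recordK₀ F Mc k + n)).d (Sect2.domCount (F.P (recordK₀ F Mc k + n)) Mc (k + 1))) (Y : (recordDomSys F Mc k (recordK₀ F Mc k + n)).Dom)
    (hY : ∀ c ∈ (Y.1 : Finset _), c ∉ ((g3cBlk F Mc k (recordK₀ F Mc k + n) q).1 : Finset _)) (x : ℝ) (φ : Sect2.CPair (F.P (recordK₀ F Mc k + n)) (MatA 2)) :
    g3cStep F Mc k (recordK₀ F Mc k + n) (TY n) q Y x φ = 0 := by
  rw [g3cStep, nonB0Block_mul_g3cProj_of_disjoint hP hMc n Y _ hY φ, Matrix.zero_mul, Matrix.zero_mul]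

/-- `S^M_{□,Y} = 0` if `Y ⊆ □̃` (inadmissible). [folklore] -/
theorem g3cStepM_eq_zero_of_subset {K : ℕ} (Mc k : ℕ) (TYK : (recordDomSys F Mc k K).Dom → Sect2.CPair (F.P K) (MatA 2) → FluctIdx F k K → FluctIdx F k K → ℂ) (x : ℝ)
    (φ : Sect2.CPair (F.P K) (MatA 2)) (s : TPt (F.P K).d (Sect2.domCount (F.P K) Mc (k + 1)) × (recordDomSys F Mc k K).Dom)
    (hs : (s.2.1 : Finset _) ⊆ (g3cBlk F Mc k K s.1).1) : g3cStepM F Mc k K TYK x φ s = 0 := by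
  rw [g3cStepM, if_pos hs]

/-- `S^M_{□,Y} = 0` if `Y ∩ □̃ = ∅`. [folklore] -/
theorem g3cStepM_eq_zero_of_disjoint (hP : P0CarrierClauses F a₀ δ₀ c₀ γ₀ γ₁ Mc α₀ α₁ ε₂₉ k TC TY TZY AdM AdZ) (hMc : McGuard F Mc) (n : ℕ)
    (s : TPt (F.P (recordK₀ F Mc k + n)).d (Sect2.domCount (F.P (recordK₀ F Mc k + n)) Mc (k + 1)) × (recordDomSys F Mc k (recordK₀ F Mc k + n)).Dom)
    (hY : ∀ c ∈ (s.2.1 : Finset _), c ∉ ((g3cBlk F Mc k (recordK₀ F Mc k + n) s.1).1 : Finset _)) (x : ℝ) (φ : Sect2.CPair (F.P (recordK₀ F Mc k + n)) (MatA 2)) :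
    g3cStepM F Mc k (recordK₀ F Mc k + n) (TY n) x φ s = 0 := by
  rw [g3cStepM]
  split_ifs
  · rfl
  · exact g3cStep_eq_zero_of_disjoint hP hMc n s.1 s.2 hY x φ

/-! ### Walk-level vanishing -/

/-- A walk with a vanishing step matrix has a vanishing term. [folklore] -/
theorem g3cWalkTerm_eq_zero_of_exists_stepM_eq_zero {K : ℕ} (Mc k : ℕ) (TYK : (recordDomSys F Mc k K).Dom → Sect2.CPair (F.P K) (MatA 2) → FluctIdx F k K → FluctIdx F k K → ℂ)
    (x : ℝ) (φ : Sect2.CPair (F.P K) (MatA 2)) (q₀ : TPt (F.P K).d (Sect2.domCount (F.P K) Mc (k + 1))) {m : ℕ}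
    (w : Fin m → TPt (F.P K).d (Sect2.domCount (F.P K) Mc (k + 1)) × (recordDomSys F Mc k K).Dom) (h : ∃ i, g3cStepM F Mc k K TYK x φ (w i) = 0) :
    g3cWalkTerm F Mc k K TYK x φ q₀ w = 0 := by
  rw [g3cWalkTerm]
  have hz : (List.ofFn fun i => g3cStepM F Mc k K TYK x φ (w i)).prod = 0 :=
    List.prod_eq_zero (List.mem_ofFn.2 h)
  rw [hz, Matrix.mul_zero, Matrix.trace_zero]

/-- ★ **Inadmissible step ⟹ `t = 0`.** [folklore] -/
theorem g3cWalkTerm_eq_zero_of_subset {K : ℕ} (Mc k : ℕ) (TYK : (recordDomSys F Mc k K).Dom → Sect2.CPair (F.P K) (MatA 2) → FluctIdx F k K → FluctIdx F k K → ℂ)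
    (x : ℝ) (φ : Sect2.CPair (F.P K) (MatA 2)) (q₀ : TPt (F.P K).d (Sect2.domCount (F.P K) Mc (k + 1))) {m : ℕ}
    (w : Fin m → TPt (F.P K).d (Sect2.domCount (F.P K) Mc (k + 1)) × (recordDomSys F Mc k K).Dom) (i : Fin m)
    (hi : ((w i).2.1 : Finset _) ⊆ (g3cBlk F Mc k K (w i).1).1) : g3cWalkTerm F Mc k K TYK x φ q₀ w = 0 :=
  g3cWalkTerm_eq_zero_of_exists_stepM_eq_zero Mc k TYK x φ q₀ w ⟨i, g3cStepM_eq_zero_of_subset Mc k TYK x φ _ hi⟩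

/-- ★ **A step missing its block ⟹ `t = 0`.** [cite: Balaban1985BackgroundPropagators, (3.88) p.409] -/
theorem g3cWalkTerm_eq_zero_of_disjoint (hP : P0CarrierClauses F a₀ δ₀ c₀ γ₀ γ₁ Mc α₀ α₁ ε₂₉ k TC TY TZY AdM AdZ) (hMc : McGuard F Mc) (n : ℕ) (x : ℝ)
    (φ : Sect2.CPair (F.P (recordK₀ F Mc k + n)) (MatA 2)) (q₀ : TPt (F.P (recordK₀ F Mc k + n)).d (Sect2.domCount (F.P (recordK₀ F Mc k + n)) Mc (k + 1))) {m : ℕ}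
    (w : Fin m → TPt (F.P (recordK₀ F Mc k + n)).d (Sect2.domCount (F.P (recordK₀ F Mc k + n)) Mc (k + 1)) × (recordDomSys F Mc k (recordK₀ F Mc k + n)).Dom) (i : Fin m)
    (hi : ∀ c ∈ ((w i).2.1 : Finset _), c ∉ ((g3cBlk F Mc k (recordK₀ F Mc k + n) (w i).1).1 : Finset _)) :
    g3cWalkTerm F Mc k (recordK₀ F Mc k + n) (TY n) x φ q₀ w = 0 :=
  g3cWalkTerm_eq_zero_of_exists_stepM_eq_zero Mc k (TY n) x φ q₀ w ⟨i, g3cStepM_eq_zero_of_disjoint hP hMc n _ hi x φ⟩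

/-- ★ **The root must lie in the first piece**: `□₀ ∉ Y₁ ⟹ t = 0`. [cite: Balaban1985BackgroundPropagators, (3.90) p.409] -/
theorem g3cWalkTerm_eq_zero_of_root_not_mem (hP : P0CarrierClauses F a₀ δ₀ c₀ γ₀ γ₁ Mc α₀ α₁ ε₂₉ k TC TY TZY AdM AdZ) (hMc : McGuard F Mc) (n : ℕ) (x : ℝ)
    (φ : Sect2.CPair (F.P (recordK₀ F Mc k + n)) (MatA 2)) (q₀ : TPt (F.P (recordK₀ F Mc k + n)).d (Sect2.domCount (F.P (recordK₀ F Mc k + n)) Mc (k + 1))) {m : ℕ}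
    (w : Fin (m + 1) → TPt (F.P (recordK₀ F Mc k + n)).d (Sect2.domCount (F.P (recordK₀ F Mc k + n)) Mc (k + 1)) × (recordDomSys F Mc k (recordK₀ F Mc k + n)).Dom)
    (h0 : q₀ ∉ ((w 0).2.1 : Finset _)) :
    g3cWalkTerm F Mc k (recordK₀ F Mc k + n) (TY n) x φ q₀ w = 0 := by
  rw [g3cWalkTerm, List.ofFn_succ, List.prod_cons, Matrix.mul_assoc, ← Matrix.mul_assoc (g3cInd F Mc k _ q₀),
    g3cInd_mul_g3cStepM_of_not_mem hP hMc n q₀ (w 0) h0 x φ, Matrix.zero_mul, Matrix.mul_zero, Matrix.trace_zero]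

/-- Consecutive steps `S^M(w_i)·S^M(w_{i+1})` with `□(w_i) ∉ Y(w_{i+1})` kill the ordered product. [cite: Balaban1985BackgroundPropagators, (3.90) p.409] -/
theorem prod_ofFn_stepM_eq_zero_of_consec (hP : P0CarrierClauses F a₀ δ₀ c₀ γ₀ γ₁ Mc α₀ α₁ ε₂₉ k TC TY TZY AdM AdZ) (hMc : McGuard F Mc) (n : ℕ) (x : ℝ)
    (φ : Sect2.CPair (F.P (recordK₀ F Mc k + n)) (MatA 2)) :
    ∀ (m : ℕ) (w : Fin m → TPt (F.P (recordK₀ F Mc k + n)).d (Sect2.domCount (F.P (recordK₀ F Mc k + n)) Mc (k + 1)) × (recordDomSys F Mc k (recordK₀ F Mc k + n)).Dom)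
      (i j : Fin m), j.val = i.val + 1 → (w i).1 ∉ ((w j).2.1 : Finset _) →
      (List.ofFn fun l => g3cStepM F Mc k (recordK₀ F Mc k + n) (TY n) x φ (w l)).prod = 0 := by
  intro m
  induction m with
  | zero => intro w i; exact i.elim0
  | succ m ih =>
      intro w i j hij hmem
      rw [List.ofFn_succ', List.prod_concat]
      by_cases hj : j.val < m
      · -- both indices in the initial segment
        have hi : i.val < m := by omega
        have h := ih (fun l => w l.castSucc) ⟨i.val, hi⟩ ⟨j.val, hj⟩ hij (by simpa using hmem)
        have e : (List.ofFn fun l : Fin m => g3cStepM F Mc k (recordK₀ F Mc k + n) (TY n) x φ (w l.castSucc)) =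
            List.ofFn fun l : Fin m => g3cStepM F Mc k (recordK₀ F Mc k + n) (TY n) x φ ((fun l => w l.castSucc) l) := rfl
        rw [e, h, Matrix.zero_mul]
      · -- j is the last index, i the one before
        have hjm : j = Fin.last m := Fin.ext (by simp [Fin.val_last]; omega)
        cases m with
        | zero => omega
        | succ m =>
            have hi : i = (Fin.last m).castSucc := Fin.ext (by simp [Fin.val_last]; omega)
            rw [List.ofFn_succ', List.prod_concat, Matrix.mul_assoc]
            subst hjm; subst hi
            rw [← g3cStepM_mul_g3cInd Mc k (TY n) x φ (w (Fin.last m).castSucc), Matrix.mul_assoc (g3cStepM F Mc k _ (TY n) x φ _),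
              g3cInd_mul_g3cStepM_of_not_mem hP hMc n _ _ hmem x φ, Matrix.mul_zero, Matrix.mul_zero]

/-- ★ **Consecutive cubes must lie in the next piece**: `□_i ∉ Y_{i+1} ⟹ t = 0`. [cite: Balaban1985BackgroundPropagators, (3.90) p.409] -/
theorem g3cWalkTerm_eq_zero_of_consec_not_mem (hP : P0CarrierClauses F a₀ δ₀ c₀ γ₀ γ₁ Mc α₀ α₁ ε₂₉ k TC TY TZY AdM AdZ) (hMc : McGuard F Mc) (n : ℕ) (x : ℝ)
    (φ : Sect2.CPair (F.P (recordK₀ F Mc k + n)) (MatA 2)) (q₀ : TPt (F.P (recordK₀ F Mc k + n)).d (Sect2.domCount (F.P (recordK₀ F Mc k + n)) Mc (k + 1))) {m : ℕ}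
    (w : Fin m → TPt (F.P (recordK₀ F Mc k + n)).d (Sect2.domCount (F.P (recordK₀ F Mc k + n)) Mc (k + 1)) × (recordDomSys F Mc k (recordK₀ F Mc k + n)).Dom)
    (i j : Fin m) (hij : j.val = i.val + 1) (hmem : (w i).1 ∉ ((w j).2.1 : Finset _)) :
    g3cWalkTerm F Mc k (recordK₀ F Mc k + n) (TY n) x φ q₀ w = 0 := by
  rw [g3cWalkTerm, prod_ofFn_stepM_eq_zero_of_consec hP hMc n x φ m w i j hij hmem, Matrix.mul_zero, Matrix.trace_zero]

end Record

end Summit.QuantumFields.YangMills.Theorems.BalabanUVNodesPortS1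

end
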